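import Mathlib
import Summits.NavierStokesRegularity.NavierStokesRegularity.Theorems.TaoLadderRungThreeGappedFrontRobustTailStep
import HarnessLib

/-!
# `BarrierSoundness` (route `BarrierStepRungThree`), tools II-a: the LOWER tail of a pseudo-flow —
  an empty block of low shells stays empty

Helper lemmas for item stmt-NavierStokesRegularity-23421 (`BarrierSoundness`, repaired form K2′): Tao-type
MODEL lattice pseudo-flows (`TaoCascade.PseudoFlowOn`) with a CANCELLING table, using the tree's bond
flux `botSum` (`TaoCascadeNoLow`) and the block energy inequality of `Theorems.GappedFrontRobust`:

* `pseudoFlowOn_botSum_small_of_le` — the bond flux `botSum(N)` is uniformly small on `[0, τ]` as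
  `N → -∞` (a priori bound (4.5) and the factor `(1+ε₀)^{5N/2}`);
* `pseudoFlowOn_lower_block_zero` — **no very low frequencies is preserved**: if the start energies
  vanish at every shell `k ≤ K₀`, they vanish there (together with the amplitudes) throughout `[0, τ]`
  (the flux out of the block through the bond `K₀ | K₀+1` carries two factors AT `K₀`, so the block
  energy obeys a linear Grönwall inequality from `0`; compare Tao's (4.11)/(4.13)). This is what lets a
  description `P` remember "finitely many active shells below the window", so that the per-shell
  bookkeeping below the window is a bootstrap over finitely many constraints.

HONEST FRAMING: nothing here is a statement about the Navier–Stokes equations and nothing is asserted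
about any table; the route's rung leaf (`TaoLadderRungThree.Target`, TL-M3) is not the summit Statement.
-/

noncomputable section

-- the sub-problem namespace `Summit.NavierStokesRegularity.NavierStokesRegularity` repeats the summit name by design (D-0017)
set_option linter.dupNamespace false

namespace Summit.NavierStokesRegularity.NavierStokesRegularity.Theorems

namespace BarrierSoundness

open Set MeasureTheory intervalIntegral Filter Topology
open Literature.Analysis.FluidPDE Literature.Analysis.FluidPDE.TaoCascade GappedFrontRobust

variable {m : ℕ} {τ ε₀ : ℝ} {α : Fin m → Fin m → Fin m → ℤ × ℤ × ℤ → ℝ} {κ₁ κ₂ : ℝ}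
  {S₀ F₀ B₀ : Fin m → ℤ → ℝ} {S F : Fin m → ℤ → ℝ → ℝ}

/-! ### The bond flux is small at very low shells -/

/-- **The bond flux at very low shells is uniformly small**: along a pseudo-flow on `[0, τ]`
(`ε₀ > 0`), for every `δ > 0` there is `N₀` with `|botSum(N)(u)| ≤ δ` for all `N ≤ N₀` and all
`u ∈ [0, τ]` (the amplitudes are uniformly bounded by (4.5) and `botSum(N)` carries the factor
`(1+ε₀)^{5N/2} → 0` as `N → -∞`). [cite: Tao2016AveragedNS, §4 Lemma 4.1 (4.5) and proof of (4.13)] -/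
theorem pseudoFlowOn_botSum_small_of_le (h : PseudoFlowOn τ ε₀ α κ₁ κ₂ S₀ F₀ B₀ S F) (hε : 0 < ε₀)
    {δ : ℝ} (hδ : 0 < δ) :
    ∃ N₀ : ℤ, ∀ N : ℤ, N ≤ N₀ → ∀ u ∈ Icc 0 τ, |botSum ε₀ α S N u| ≤ δ := by
  have hq : 0 < 1 + ε₀ := by linarith
  have hq1 : 1 ≤ 1 + ε₀ := by linarith
  obtain ⟨M, hM⟩ := h.apriori_S
  set M' : ℝ := max M 0 with hM'
  have hM'0 : 0 ≤ M' := le_max_right _ _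
  have hX : ∀ u ∈ Icc 0 τ, ∀ (i : Fin m) (k : ℤ), |S i k u| ≤ M' := fun u hu i k =>
    (abs_le_of_weight hq ((hM u hu i k).trans (le_max_left _ _))).2
  set C : ℝ := ∑ i₁ : Fin m, ∑ i₂ : Fin m, ∑ i₃ : Fin m, |α i₁ i₂ i₃ (0, 0, 1)| with hCdef
  have hC : 0 ≤ C := Finset.sum_nonneg fun _ _ => Finset.sum_nonneg fun _ _ =>
    Finset.sum_nonneg fun _ _ => abs_nonneg _
  -- choose n with ((1+ε₀)⁻¹)^n < δ / (M'^3 C + 1)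
  have hbinv : (1 + ε₀)⁻¹ < 1 := inv_lt_one_of_one_lt₀ (by linarith)
  have hbinv0 : 0 < (1 + ε₀)⁻¹ := inv_pos.mpr hq
  have hden : 0 < M' ^ 3 * C + 1 := by positivity
  obtain ⟨n, hn⟩ := exists_pow_lt_of_lt_one (div_pos hδ hden) hbinv
  refine ⟨-(n : ℤ), fun N hN u hu => ?_⟩
  have hN0 : (N : ℝ) ≤ -(n : ℝ) := by exact_mod_cast hN
  have hb := abs_botSum_le_of_abs_le ε₀ hq α S N u (fun i => hX u hu i N) (fun i => hX u hu i (N + 1))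
  -- (1+ε₀)^{5N/2} ≤ (1+ε₀)^{N} ≤ (1+ε₀)^{-n} = ((1+ε₀)⁻¹)^n
  have hNn : (N : ℝ) ≤ 0 := hN0.trans (by simp)
  have h1 : (1 + ε₀) ^ ((5 : ℝ) * N / 2) ≤ ((1 + ε₀)⁻¹) ^ n := by
    have : (1 + ε₀) ^ ((5 : ℝ) * N / 2) ≤ (1 + ε₀) ^ (-(n : ℝ)) :=
      Real.rpow_le_rpow_of_exponent_le hq1 (by nlinarith)
    refine this.trans (le_of_eq ?_)
    rw [Real.rpow_neg hq.le, Real.rpow_natCast, inv_pow]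
  calc |botSum ε₀ α S N u| ≤ (1 + ε₀) ^ ((5 : ℝ) * N / 2) * M' ^ 2 * M' * C := hb
    _ = (1 + ε₀) ^ ((5 : ℝ) * N / 2) * (M' ^ 3 * C) := by ring
    _ ≤ ((1 + ε₀)⁻¹) ^ n * (M' ^ 3 * C) := by gcongr
    _ ≤ δ / (M' ^ 3 * C + 1) * (M' ^ 3 * C) :=
        mul_le_mul_of_nonneg_right hn.le (by positivity)
    _ ≤ δ := by
        rw [div_mul_eq_mul_div, div_le_iff₀ hden]
        nlinarith

/-! ### An empty block of low shells stays empty -/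

/-- **No very low frequencies is preserved along a pseudo-flow.** Along a pseudo-flow on `[0, τ]`
(`τ > 0`, `ε₀ > 0`, cancelling table), if the start energies vanish at every shell `k ≤ K₀` (all modes),
then the energies AND the amplitudes vanish at every shell `k ≤ K₀` throughout `[0, τ]`. Proof: for a
cutoff `K' ≤ K₀` the energy `E` of the block `K', …, K₀` is `C¹` with `E' ≤ botSum(K'-1) - botSum(K₀)`
((4.9) summed, (4.3) telescoped), `|botSum(K₀)| ≤ 2(1+ε₀)^{5K₀/2} Q (∑|α_{·,(0,0,1)}|) E` (two factors
at `K₀`, `Q` an a priori amplitude bound) and `|botSum(K'-1)| ≤ δ_{K'} → 0` as `K' → -∞`; Grönwall from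
`E(0) = 0` and `δ_{K'} → 0`. Compare Tao's (4.11)/(4.13).
[cite: Tao2016AveragedNS, §4 Lemma 4.1 (4.9), (4.11) and proof of (4.13)] -/
theorem pseudoFlowOn_lower_block_zero (h : PseudoFlowOn τ ε₀ α κ₁ κ₂ S₀ F₀ B₀ S F)
    (hε : 0 < ε₀) (hα : IsCancellingCoeff α) (K₀ : ℤ) (hzero : ∀ i k, k ≤ K₀ → F₀ i k = 0) :
    ∀ s ∈ Icc 0 τ, ∀ (i : Fin m) (k : ℤ), k ≤ K₀ → F i k s = 0 ∧ S i k s = 0 := by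
  have hq : 0 < 1 + ε₀ := by linarith
  have hS : ∀ i n, ContinuousOn (S i n) (Icc 0 τ) := fun i n => (h.contDiffOn_S i n).continuousOn
  have hFc : ∀ i n, ContinuousOn (F i n) (Icc 0 τ) := fun i n => (h.contDiffOn_F i n).continuousOn
  -- an a priori amplitude bound Q ≥ 0
  obtain ⟨M, hM⟩ := h.apriori_S
  set Q : ℝ := max M 0 with hQdef
  have hQ0 : 0 ≤ Q := le_max_right _ _
  have hX : ∀ u ∈ Icc 0 τ, ∀ (i : Fin m) (k : ℤ), |S i k u| ≤ Q := fun u hu i k =>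
    (abs_le_of_weight hq ((hM u hu i k).trans (le_max_left _ _))).2
  set A : ℝ := ∑ i₁ : Fin m, ∑ i₂ : Fin m, ∑ i₃ : Fin m, |α i₁ i₂ i₃ (0, 0, 1)| with hAdef
  have hA : 0 ≤ A := Finset.sum_nonneg fun _ _ => Finset.sum_nonneg fun _ _ =>
    Finset.sum_nonneg fun _ _ => abs_nonneg _
  -- the Grönwall constant
  set C : ℝ := 2 * (1 + ε₀) ^ ((5 : ℝ) * K₀ / 2) * Q * A with hCdef
  have hC0 : 0 ≤ C := by positivity
  -- main estimate: for every cutoff K' ≤ K₀ with top flux ≤ δ, the block energy is ≤ gronwallBound 0 C δ s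
  have key : ∀ (δ : ℝ) (K' : ℤ), K' ≤ K₀ → (∀ u ∈ Icc 0 τ, |botSum ε₀ α S (K' - 1) u| ≤ δ) →
      ∀ s ∈ Icc 0 τ, ∑ k ∈ Finset.range (K₀ - K' + 1).toNat, ∑ i, F i (K' + k) s ≤
        gronwallBound 0 C δ (s - 0) := by
    intro δ K' hK' hδ
    set L : ℕ := (K₀ - K' + 1).toNat with hL
    have hLK : K' + L - 1 = K₀ := by
      rw [hL, Int.toNat_of_nonneg (by linarith)]; ring
    set E : ℝ → ℝ := fun s => ∑ k ∈ Finset.range L, ∑ i, F i (K' + k) s with hE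
    set E' : ℝ → ℝ := fun s => ∑ k ∈ Finset.range L, ∑ i, derivWithin (F i (K' + k)) (Icc 0 τ) s
      with hE'
    have hEcont : ContinuousOn E (Icc 0 τ) :=
      continuousOn_finsetSum _ fun k _ => continuousOn_finsetSum _ fun i _ => hFc i (K' + k)
    have hEderiv : ∀ x ∈ Icc 0 τ, HasDerivWithinAt E (E' x) (Icc 0 τ) x := by
      intro x hx
      simp only [hE, hE']
      refine HasDerivWithinAt.fun_sum fun k _ => HasDerivWithinAt.fun_sum fun i _ => ?_
      exact ((h.contDiffOn_F i (K' + k)).differentiableOn one_ne_zero x hx).hasDerivWithinAt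
    have hEderiv' : ∀ x ∈ Ico 0 τ, HasDerivWithinAt E (E' x) (Ici x) x := by
      intro x hx
      refine (hEderiv x ⟨hx.1, hx.2.le⟩).mono_of_mem_nhdsWithin ?_
      exact mem_of_superset (Icc_mem_nhdsGE hx.2) (Icc_subset_Icc_left hx.1)
    have hE0 : E 0 ≤ 0 := by
      simp only [hE]
      refine le_of_eq (Finset.sum_eq_zero fun k hk => Finset.sum_eq_zero fun i _ => ?_)
      rw [h.init_F]
      have hk : (k : ℤ) < L := by exact_mod_cast Finset.mem_range.mp hk
      exact hzero i (K' + k) (by linarith)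
    have hEnonneg : ∀ s ∈ Icc 0 τ, 0 ≤ E s := fun s hs =>
      Finset.sum_nonneg fun k _ => Finset.sum_nonneg fun i _ => h.nonneg_F i (K' + k) s hs
    -- E' ≤ botSum(K'-1) - botSum(K₀) ≤ δ + C E
    have hbound : ∀ x ∈ Ico 0 τ, E' x ≤ C * E x + δ := by
      intro x hx
      have hx' : x ∈ Icc 0 τ := ⟨hx.1, hx.2.le⟩
      have h1 : E' x ≤ ∑ k ∈ Finset.range L, ∑ i, quadTerm ε₀ α S i (K' + k) x * S i (K' + k) x := by
        simp only [hE']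
        exact Finset.sum_le_sum fun k _ => Finset.sum_le_sum fun i _ => h.energy i (K' + k) x hx'
      rw [sum_range_sum_quadTerm_mul_eq_botSum ε₀ hα S K' L x, hLK] at h1
      -- the top flux: two factors at K₀, which lies in the block
      have htop : |botSum ε₀ α S K₀ x| ≤ C * E x := by
        have hb := abs_botSum_le_energy ε₀ hq α S F K₀ x (fun i => hX x hx' i (K₀ + 1))
          (fun i => h.nonneg_F i K₀ x hx') (fun i => h.defect_lower i K₀ x hx')
        have hmem : (K₀ - K').toNat ∈ Finset.range L := by
          rw [Finset.mem_range, hL]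
          have h0 : 0 ≤ K₀ - K' := by linarith
          zify [h0]
          rw [Int.toNat_of_nonneg h0, Int.toNat_of_nonneg (by linarith)]
          linarith
        have hK₀ : K' + ((K₀ - K').toNat : ℤ) = K₀ := by
          rw [Int.toNat_of_nonneg (by linarith)]; ring
        have hshell : ∑ i, F i K₀ x ≤ E x := by
          have := Finset.single_le_sum (f := fun k : ℕ => ∑ i, F i (K' + k) x)
            (fun k _ => Finset.sum_nonneg fun i _ => h.nonneg_F i (K' + k) x hx') hmem
          simpa only [hK₀] using this
        calc |botSum ε₀ α S K₀ x|
            ≤ 2 * (1 + ε₀) ^ ((5 : ℝ) * K₀ / 2) * Q * A * ∑ i, F i K₀ x := hb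
          _ ≤ 2 * (1 + ε₀) ^ ((5 : ℝ) * K₀ / 2) * Q * A * E x :=
              mul_le_mul_of_nonneg_left hshell (by positivity)
          _ = C * E x := by rw [hCdef]
      have hlow := hδ x hx'
      have := neg_abs_le (botSum ε₀ α S K₀ x)
      have := le_abs_self (botSum ε₀ α S (K' - 1) x)
      linarith [abs_nonneg (botSum ε₀ α S K₀ x)]
    have hgr := le_gronwallBound_of_liminf_deriv_right_le hEcont
      (fun x hx r hr => ((hEderiv' x hx).liminf_right_slope_le hr).mono fun z hz => by
        rwa [slope_def_field, div_eq_inv_mul] at hz) hE0 hbound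
    simpa only [hE] using hgr
  -- conclusion: each F i k s (k ≤ K₀) is below gronwallBound 0 C δ s for every δ > 0, hence ≤ 0
  intro s hs i k hk
  have hFle : ∀ δ : ℝ, 0 < δ → F i k s ≤ gronwallBound 0 C δ (s - 0) := by
    intro δ hδ
    obtain ⟨N₀, hN₀⟩ := pseudoFlowOn_botSum_small_of_le h hε hδ
    -- cutoff K' := min (N₀ + 1) k
    set K' : ℤ := min (N₀ + 1) k with hK'
    have hK'k : K' ≤ k := min_le_right _ _
    have hK'N : K' - 1 ≤ N₀ := by have := min_le_left (N₀ + 1) k; omega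
    have hkey := key δ K' (hK'k.trans hk) (fun u hu => hN₀ (K' - 1) hK'N u hu) s hs
    have hmem : (k - K').toNat ∈ Finset.range (K₀ - K' + 1).toNat := by
      rw [Finset.mem_range]
      have h0 : 0 ≤ k - K' := by linarith
      zify
      rw [Int.toNat_of_nonneg h0, Int.toNat_of_nonneg (by linarith)]
      linarith
    have hkK : K' + ((k - K').toNat : ℤ) = k := by
      rw [Int.toNat_of_nonneg (by linarith)]; ring
    have h1 : F i k s ≤ ∑ j, F j k s :=
      Finset.single_le_sum (f := fun j => F j k s) (fun j _ => h.nonneg_F j k s hs) (Finset.mem_univ i)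
    have h2 : ∑ j, F j k s ≤ ∑ k' ∈ Finset.range (K₀ - K' + 1).toNat, ∑ j, F j (K' + k') s := by
      have := Finset.single_le_sum (f := fun k' : ℕ => ∑ j, F j (K' + k') s)
        (fun k' _ => Finset.sum_nonneg fun j _ => h.nonneg_F j (K' + k') s hs) hmem
      simpa only [hkK] using this
    exact h1.trans (h2.trans hkey)
  have hF0 : F i k s ≤ 0 := by
    -- continuity of the Grönwall bound in ε at ε = 0, where it vanishes
    have hcont := (gronwallBound_continuous_ε 0 C (s - 0)).continuousAt (x := 0)
    rw [ContinuousAt, gronwallBound_ε0_δ0] at hcont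
    by_contra hpos
    push Not at hpos
    have hev : ∀ᶠ δ in 𝓝 (0 : ℝ), gronwallBound 0 C δ (s - 0) < F i k s :=
      hcont (Iio_mem_nhds hpos)
    obtain ⟨η', hη', hball⟩ := Metric.eventually_nhds_iff.mp hev
    have h1 := hball (y := η' / 2) (by rw [Real.dist_eq]; rw [abs_of_pos (by linarith)]; linarith)
    have h2 := hFle (η' / 2) (by linarith)
    linarith
  have hF := le_antisymm hF0 (h.nonneg_F i k s hs)
  refine ⟨hF, ?_⟩
  have hsq := h.defect_lower i k s hs
  rw [hF] at hsq
  nlinarith [sq_nonneg (S i k s)]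

end BarrierSoundness

end Summit.NavierStokesRegularity.NavierStokesRegularity.Theorems

end
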